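import Literature.AlgebraicGeometry.Resolution.TangentDirections
import Literature.AlgebraicGeometry.Resolution.KollarTuning
import Literature.AlgebraicGeometry.Resolution.MarkedIdealsArithmetic
import Literature.AlgebraicGeometry.Resolution.RegularLocalOrder
import Mathlib.Data.Nat.Factorial.BigOperators
import HarnessLib

/-!
# The homogenized ideal `ℋ(𝓘, μ)` and the coefficient ideal `𝒞(𝓘, μ)` of a marked ideal — sheaf level (BGMW 2011, §3.8, Def. 3.9.2)

Topic: `Literature/AlgebraicGeometry/Resolution`. DEFINITIONS (with unfolding API, stalk
formulas and the support statements proved) for the decomposition of the named fact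
`BierstoneGrigorievMilmanWlodarczyk2011_canonical` (`CanonicalResolution.lean`; Bierstone–
Grigoriev–Milman–Włodarczyk, arXiv:1206.3090, Thm. 8.0.5): Step 1 of the resolution algorithm
(§4, p. 11) replaces a marked ideal `(𝓘, μ)` of maximal order "with the equivalent homogenized
ideal `𝒞(ℋ(𝓘, μ))`", where

  §3.8: "Let `(𝓘, μ)` be a marked ideal of maximal order. Set `T(𝓘) := 𝒟^{μ-1}𝓘`. By the
  homogenized ideal we mean
  `ℋ(𝓘, μ) := (ℋ(𝓘), μ) = (𝓘 + 𝒟𝓘·T(𝓘) + … + 𝒟ⁱ𝓘·T(𝓘)ⁱ + … + 𝒟^{μ-1}𝓘·T(𝓘)^{μ-1}, μ)`",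

  Def. 3.9.2: "Let `(𝓘, μ)` be a marked ideal of maximal order. By the coefficient ideal we mean
  `𝒞(𝓘, μ) = Σ_{i=1}^{μ} (𝒟ⁱ𝓘, μ - i)`" (sum of marked ideals in the sense of §3.7 (1):
  `(𝓘_1, μ_1) + … + (𝓘_m, μ_m) := (Σᵢ 𝓘ᵢ^{Π_{j≠i} μ_j}, Π_j μ_j)`),

the boundary `E` being unchanged (§3.7: "all marked ideals are defined for … the same set of
exceptional divisors `E`"). The tree has these at the RING level (`homogenizedIdeal`,
`coeffIdeal`, `CoefficientIdeals.lean`); here they are sheafified over the marked ideals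
`MarkedIdeal X` (`MarkedIdeals.lean`) and the derivative ideal sheaves `𝒟ⁱ`
(`derivIdealSheafIter φ`, `DerivativeIdealSheaf.lean`) of a scheme with `k`-structure `φ`:

* `stalkIdeal_iSup` — stalks of suprema of ideal sheaves [folklore]; `markedSum_ofFn` — the
  ring-level sum of marked ideals (`markedSum`, `CoefficientIdeals.lean`) on a `List.ofFn`,
  reindexed by `Fin μ`;
* `MarkedIdeal.tangent φ M = T(𝓘) = 𝒟^{μ-1}(𝓘)` (Def. 3.6.5 / §3.8) — an `abbrev` of the tree's
  `maxContactIdealSheaf φ 𝓘 μ` (`KollarTuning.lean`, Kollár Def. 3.79: Kollár's `MC(I)` IS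
  BGMW's `T(𝓘)`; at ring level `maxContactIdeal = tangentIdeal` likewise), so the BGMW and Kollár
  layers share one object;
* `MarkedIdeal.homogenized φ M = ℋ(𝓘, μ)`; `homogenized_ideal_apply` (on affine opens it is the
  ring-level `homogenizedIdeal`), `stalkIdeal_homogenized` (`ℋ(𝓘)_x = ℋ(𝓘_x)`),
  `ideal_le_homogenized_ideal`, `homogenized_ideal_le_tangent`, `IsOfMaxOrder.homogenized`
  (`ℋ(𝓘, μ)`, `μ ≥ 1`, is again of maximal order), and **`support_homogenized`** —
  `supp(ℋ(𝓘), μ) = supp(𝓘, μ)` (the support part of Lemma 3.8.1 (1), `(𝓘, μ) ≃ (ℋ(𝓘), μ)`);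
* `MarkedIdeal.coeff φ M = 𝒞(𝓘, μ)` with the range `i = 0, …, μ - 1` (as used in the proof of
  Lemma 3.9.3 and in the ring-level `coeffIdeal`; the printed range `i = 1, …, μ` would contain
  the term `(𝒟^μ𝓘, 0)` and force the total multiplicity `Π (μ - i)` to vanish — see the docstring
  of `coeffIdeal`): `(Σ_{i<μ} (𝒟ⁱ𝓘)^{Π_{j<μ, j≠i}(μ-j)}, Π_{j<μ}(μ-j))`; `coeff_ideal_apply`,
  `coeff_mult_eq_coeffIdeal` (on affine opens it IS the ring-level `coeffIdeal`), `coeff_mult`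
  (`= μ!`), `stalkIdeal_coeff`, **`support_subset_support_coeff`** (`supp(𝓘, μ) ⊆ supp 𝒞(𝓘, μ)`,
  every characteristic, every scheme) and **`support_coeff`** (`supp 𝒞(𝓘, μ) = supp(𝓘, μ)` at
  points with regular local ring, `μ ≥ 1`: the support part of Lemma 3.9.3,
  `𝒞(𝓘, μ) ≃ (𝓘, μ)`, via `ord_x(fᵉ) = e·ord_x(f)` in a regular local ring,
  `RegularLocalOrder.lean`).

The equivalences `≃` of Lemmas 3.8.1 and 3.9.3 (Def. 3.4.1: same multiple blow-ups, same
supports along them) and Lemmas 3.8.2–3.8.3, 3.9.4–3.9.5 are not treated here.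

## Sources

* E. Bierstone, D. Grigoriev, P. Milman, J. Włodarczyk, arXiv:1206.3090 (arXiv numbering):
  §3.7 (1) (p. 8), §3.8 and Lemma 3.8.1 (pp. 8–9), Def. 3.9.2, Lemma 3.9.3 (p. 10), §4 Step 1
  (p. 11). [BierstoneGrigorievMilmanWlodarczyk2011]
* J. Kollár, *Lectures on Resolution of Singularities* (2007), Def. 3.79 (`MC(I) = D^{m-1} I`).
  [Kollar2007]
-/

noncomputable section

open CategoryTheory AlgebraicGeometry TopologicalSpace IsLocalRing

namespace Literature.AlgebraicGeometry.Resolution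

universe u v

/-! ## Stalks and sections of suprema and powers of ideal sheaves -/

section Lattice

variable {X : Scheme.{u}}

/-- Stalks commute with suprema of ideal sheaves. [folklore] -/
theorem stalkIdeal_iSup {ι : Type*} (I : ι → X.IdealSheafData) (x : X) :
    stalkIdeal (⨆ i, I i) x = ⨆ i, stalkIdeal (I i) x := by
  obtain ⟨U, hU, hxU, -⟩ :=
    exists_isAffineOpen_mem_and_subset (X := X) (x := x) (U := ⊤) (Opens.mem_top x)
  rw [stalkIdeal_eq_map_germ _ ⟨U, hU⟩ hxU, Scheme.IdealSheafData.ideal_iSup, iSup_apply,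
    Ideal.map_iSup]
  simp only [stalkIdeal_eq_map_germ _ ⟨U, hU⟩ hxU]

/-- A finite supremum indexed by `Fin n` is the bounded supremum over `Finset.range n`. [folklore] -/
theorem iSup_fin_eq_biSup_range {α : Type*} [CompleteLattice α] (n : ℕ) (f : ℕ → α) :
    (⨆ i : Fin n, f i) = ⨆ i ∈ Finset.range n, f i := by
  apply le_antisymm
  · exact iSup_le fun i => le_iSup₂_of_le (f := fun i (_ : i ∈ Finset.range n) => f i)
      (i : ℕ) (Finset.mem_range.mpr i.2) le_rfl
  · exact iSup₂_le fun i hi => le_iSup_of_le (f := fun i : Fin n => f i)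
      ⟨i, Finset.mem_range.mp hi⟩ le_rfl

/-- **The sum of marked ideals on an explicit family** (BGMW §3.7 (1), ring level): for
`f : Fin μ → Ideal A × ℕ`, `markedSum (List.ofFn f) = (Σᵢ (f i).1^{Π_{j≠i} (f j).2}, Πⱼ (f j).2)`
with the sums and products indexed by `Fin μ` (reindexing `Fin (List.ofFn f).length ≃ Fin μ`).
[cite: BierstoneGrigorievMilmanWlodarczyk2011, §3.7 (1)] -/
theorem markedSum_ofFn {A : Type*} [CommRing A] {μ : ℕ} (f : Fin μ → Ideal A × ℕ) :
    markedSum (List.ofFn f) =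
      (∑ i : Fin μ, (f i).1 ^ (∏ j ∈ Finset.univ.erase i, (f j).2), ∏ j : Fin μ, (f j).2) := by
  classical
  have hlen : (List.ofFn f).length = μ := List.length_ofFn
  let e : Fin (List.ofFn f).length ≃ Fin μ := finCongr hlen
  have hget : ∀ i, (List.ofFn f).get i = f (e i) := fun i => List.get_ofFn f i
  unfold markedSum
  refine Prod.ext ?_ ?_
  · change (∑ i : Fin (List.ofFn f).length, ((List.ofFn f).get i).1 ^
        (∏ j ∈ Finset.univ.erase i, ((List.ofFn f).get j).2)) = _
    refine Fintype.sum_equiv e _ _ fun i => ?_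
    rw [hget]
    congr 1
    refine Finset.prod_equiv e (fun j => ?_) (fun j _ => by rw [hget])
    simp only [Finset.mem_erase, Finset.mem_univ, and_true, ne_eq, e.apply_eq_iff_eq]
  · change (∏ j : Fin (List.ofFn f).length, ((List.ofFn f).get j).2) = _
    exact Fintype.prod_equiv e _ _ fun j => by rw [hget]

end Lattice

namespace MarkedIdeal

variable {k : Type v} [CommRing k] {X : Scheme.{u}} (φ : k →+* Γ(X, ⊤))

/-! ## The tangent ideal sheaf `T(𝓘) = 𝒟^{μ-1}(𝓘)` -/

/-- **The tangent ideal sheaf `T(𝓘) := 𝒟^{μ-1}(𝓘)`** of the marked ideal `(X, 𝓘, E, μ)` (BGMW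
Def. 3.6.5 / §3.8; its sections of multiplicity one are the tangent directions). This is the
tree's maximal contact ideal sheaf `maxContactIdealSheaf φ 𝓘 μ = 𝒟^{μ-1}(𝓘)` (`KollarTuning.lean`,
Kollár 2007, Def. 3.79 — Kollár's name `MC(I)` for the same object), of which `tangent` is an
`abbrev` in the marked-ideal packaging. [cite: BierstoneGrigorievMilmanWlodarczyk2011, Def. 3.6.5] -/
abbrev tangent (M : MarkedIdeal X) : X.IdealSheafData :=
  maxContactIdealSheaf φ M.ideal M.mult

/-- `T(𝓘)` is Kollár's `MC(𝓘)` (`maxContactIdealSheaf`). [cite: Kollar2007, Def. 3.79] -/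
theorem tangent_eq_maxContactIdealSheaf (M : MarkedIdeal X) :
    M.tangent φ = maxContactIdealSheaf φ M.ideal M.mult := rfl

/-- Unfolding: `T(𝓘) = 𝒟^{μ-1}(𝓘)`. [cite: BierstoneGrigorievMilmanWlodarczyk2011, Def. 3.6.5] -/
theorem tangent_eq (M : MarkedIdeal X) : M.tangent φ = derivIdealSheafIter φ (M.mult - 1) M.ideal :=
  rfl

/-- `𝓘 ⊆ T(𝓘)`. [folklore] -/
theorem ideal_le_tangent (M : MarkedIdeal X) : M.ideal ≤ M.tangent φ :=
  le_derivIdealSheafIter φ _ _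

variable {φ} in
/-- Sections of `T(𝓘)` on affine opens: the ring-level `tangentIdeal`.
[cite: BierstoneGrigorievMilmanWlodarczyk2011, Def. 3.6.5] -/
theorem tangent_ideal_apply (hX : HasFinitePresentationDifferentials φ) (M : MarkedIdeal X)
    (U : X.affineOpens) :
    (M.tangent φ).ideal U = (letI := sectionsAlgebra φ U; tangentIdeal k (M.ideal.ideal U) M.mult) :=
  derivIdealSheafIter_ideal hX _ _ U

variable {φ} in
/-- Stalks of `T(𝓘)`: `T(𝓘)_x = T(𝓘_x)`. [cite: BierstoneGrigorievMilmanWlodarczyk2011, Def. 3.6.5] -/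
theorem stalkIdeal_tangent (hX : HasFinitePresentationDifferentials φ) (M : MarkedIdeal X) (x : X) :
    stalkIdeal (M.tangent φ) x = (letI := stalkAlgebra φ x; tangentIdeal k (stalkIdeal M.ideal x) M.mult) :=
  stalkIdeal_derivIdealSheafIter hX _ _ x

/-! ## The homogenized ideal `ℋ(𝓘, μ)` (BGMW §3.8) -/

/-- **The homogenized marked ideal `ℋ(𝓘, μ) := (𝓘 + 𝒟𝓘·T(𝓘) + … + 𝒟^{μ-1}𝓘·T(𝓘)^{μ-1}, μ)`**,
`T(𝓘) = 𝒟^{μ-1}𝓘`, with the same boundary (BGMW §3.8; "It is equivalent to the given ideal"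
and "looks the same from all possible tangent directions").
[cite: BierstoneGrigorievMilmanWlodarczyk2011, §3.8] -/
def homogenized (M : MarkedIdeal X) : MarkedIdeal X where
  ideal := ⨆ i : Fin M.mult, derivIdealSheafIter φ i M.ideal * M.tangent φ ^ (i : ℕ)
  boundary := M.boundary
  mult := M.mult

/-- Unfolding. [cite: BierstoneGrigorievMilmanWlodarczyk2011, §3.8] -/
theorem homogenized_ideal (M : MarkedIdeal X) : (M.homogenized φ).ideal =
    ⨆ i : Fin M.mult, derivIdealSheafIter φ i M.ideal * M.tangent φ ^ (i : ℕ) := rfl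

/-- Unfolding. [folklore] -/
@[simp] theorem homogenized_boundary (M : MarkedIdeal X) : (M.homogenized φ).boundary = M.boundary :=
  rfl

/-- Unfolding. [folklore] -/
@[simp] theorem homogenized_mult (M : MarkedIdeal X) : (M.homogenized φ).mult = M.mult := rfl

/-- The `i`-th term of `ℋ(𝓘)`. [cite: BierstoneGrigorievMilmanWlodarczyk2011, §3.8] -/
theorem derivIdealSheafIter_mul_pow_le_homogenized_ideal (M : MarkedIdeal X) {i : ℕ} (hi : i < M.mult) :
    derivIdealSheafIter φ i M.ideal * M.tangent φ ^ i ≤ (M.homogenized φ).ideal :=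
  le_iSup_of_le (f := fun i : Fin M.mult => derivIdealSheafIter φ i M.ideal * M.tangent φ ^ (i : ℕ))
    ⟨i, hi⟩ le_rfl

/-- `𝓘 ⊆ ℋ(𝓘)` (the `i = 0` term), for `μ ≥ 1`. [cite: BierstoneGrigorievMilmanWlodarczyk2011, §3.8] -/
theorem ideal_le_homogenized_ideal (M : MarkedIdeal X) (hμ : M.mult ≠ 0) :
    M.ideal ≤ (M.homogenized φ).ideal := by
  have := M.derivIdealSheafIter_mul_pow_le_homogenized_ideal φ (Nat.pos_of_ne_zero hμ)
  rwa [derivIdealSheafIter_zero, pow_zero, mul_one] at this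

/-- `ℋ(𝓘) ⊆ B` iff every term is `⊆ B`. [folklore] -/
theorem homogenized_ideal_le_iff (M : MarkedIdeal X) {B : X.IdealSheafData} :
    (M.homogenized φ).ideal ≤ B ↔
      ∀ i < M.mult, derivIdealSheafIter φ i M.ideal * M.tangent φ ^ i ≤ B := by
  rw [homogenized_ideal, iSup_le_iff]
  exact ⟨fun h i hi => h ⟨i, hi⟩, fun h i => h i i.2⟩

/-- `ℋ(𝓘) ⊆ T(𝓘)`. [folklore] -/
theorem homogenized_ideal_le_tangent (M : MarkedIdeal X) : (M.homogenized φ).ideal ≤ M.tangent φ := by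
  refine (M.homogenized_ideal_le_iff φ).mpr fun i _ => ?_
  cases i with
  | zero => rw [pow_zero, mul_one]; exact M.ideal_le_tangent φ
  | succ j =>
    rw [pow_succ]
    refine fun U => ?_
    rw [Scheme.IdealSheafData.ideal_mul, Pi.mul_apply, Scheme.IdealSheafData.ideal_mul,
      Pi.mul_apply]
    exact Ideal.mul_le_left.trans Ideal.mul_le_left

variable {φ}

/-- **Sections of `ℋ(𝓘)` on affine opens are the ring-level homogenized ideals**:
`ℋ(𝓘)(U) = ℋ(𝓘(U))` (`homogenizedIdeal`, `CoefficientIdeals.lean`).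
[cite: BierstoneGrigorievMilmanWlodarczyk2011, §3.8] -/
theorem homogenized_ideal_apply (hX : HasFinitePresentationDifferentials φ) (M : MarkedIdeal X)
    (U : X.affineOpens) :
    (M.homogenized φ).ideal.ideal U =
      (letI := sectionsAlgebra φ U; homogenizedIdeal k (M.ideal.ideal U) M.mult) := by
  letI := sectionsAlgebra φ U
  rw [homogenized_ideal, homogenizedIdeal, Scheme.IdealSheafData.ideal_iSup, iSup_apply,
    ← iSup_fin_eq_biSup_range]
  refine iSup_congr fun i => ?_
  rw [Scheme.IdealSheafData.ideal_mul, Pi.mul_apply, Scheme.IdealSheafData.ideal_pow, Pi.pow_apply,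
    derivIdealSheafIter_ideal hX, tangent_ideal_apply hX]

/-- **Stalks of `ℋ(𝓘)`**: `ℋ(𝓘)_x = ℋ(𝓘_x)`. [cite: BierstoneGrigorievMilmanWlodarczyk2011, §3.8] -/
theorem stalkIdeal_homogenized (hX : HasFinitePresentationDifferentials φ) (M : MarkedIdeal X)
    (x : X) :
    stalkIdeal (M.homogenized φ).ideal x =
      (letI := stalkAlgebra φ x; homogenizedIdeal k (stalkIdeal M.ideal x) M.mult) := by
  letI := stalkAlgebra φ x
  rw [homogenized_ideal, homogenizedIdeal, stalkIdeal_iSup, ← iSup_fin_eq_biSup_range]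
  refine iSup_congr fun i => ?_
  rw [stalkIdeal_mul, stalkIdeal_pow, stalkIdeal_derivIdealSheafIter hX, stalkIdeal_tangent hX]

/-- **`supp(ℋ(𝓘), μ) = supp(𝓘, μ)`** (the support part of BGMW Lemma 3.8.1 (1),
`(𝓘, μ) ≃ (ℋ(𝓘), μ)`), for `μ ≥ 1`: at each point, `ℋ(𝓘)_x ⊆ 𝔪_x^μ ↔ 𝓘_x ⊆ 𝔪_x^μ`
(`homogenizedIdeal_le_pow_iff`). [cite: BierstoneGrigorievMilmanWlodarczyk2011, Lemma 3.8.1 (1)] -/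
theorem support_homogenized (hX : HasFinitePresentationDifferentials φ) (M : MarkedIdeal X)
    (hμ : M.mult ≠ 0) : (M.homogenized φ).support = M.support := by
  ext x
  rw [mem_support_iff, mem_support_iff, stalkIdeal_homogenized hX, homogenized_mult]
  letI := stalkAlgebra φ x
  exact homogenizedIdeal_le_pow_iff k hμ

variable (φ) in
/-- **`ℋ(𝓘, μ)` is of maximal order if `(𝓘, μ)` is**: `𝒟^μ(ℋ(𝓘)) ⊇ 𝒟^μ(𝓘) = 𝒪_X`.
[cite: BierstoneGrigorievMilmanWlodarczyk2011, §3.8 with Def. 3.6.1] -/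
theorem IsOfMaxOrder.homogenized {M : MarkedIdeal X} (h : M.IsOfMaxOrder φ) (hμ : M.mult ≠ 0) :
    (M.homogenized φ).IsOfMaxOrder φ := by
  rw [isOfMaxOrder_iff, homogenized_mult]
  apply top_le_iff.mp
  rw [isOfMaxOrder_iff] at h
  rw [← h]
  exact derivIdealSheafIter_mono φ _ (M.ideal_le_homogenized_ideal φ hμ)

/-! ## The coefficient ideal `𝒞(𝓘, μ)` (BGMW Def. 3.9.2) -/

variable (φ)

/-- **The coefficient marked ideal `𝒞(𝓘, μ) := Σ_{i<μ} (𝒟ⁱ𝓘, μ - i)`** (BGMW Def. 3.9.2, the sum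
of marked ideals of §3.7 (1): `(Σᵢ (𝒟ⁱ𝓘)^{Π_{j≠i}(μ-j)}, Π_j (μ - j))`, indices `i, j < μ`; same
boundary). The range `i = 0, …, μ - 1` is the one used in the proof of Lemma 3.9.3 and in the
ring-level `coeffIdeal` (`CoefficientIdeals.lean`), see there for the printed `i = 1, …, μ`.
[cite: BierstoneGrigorievMilmanWlodarczyk2011, Def. 3.9.2] -/
def coeff (M : MarkedIdeal X) : MarkedIdeal X where
  ideal := ⨆ i : Fin M.mult,
    derivIdealSheafIter φ i M.ideal ^ (∏ j ∈ Finset.univ.erase i, (M.mult - (j : ℕ)))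
  boundary := M.boundary
  mult := ∏ j : Fin M.mult, (M.mult - (j : ℕ))

/-- Unfolding. [cite: BierstoneGrigorievMilmanWlodarczyk2011, Def. 3.9.2] -/
theorem coeff_ideal (M : MarkedIdeal X) : (M.coeff φ).ideal = ⨆ i : Fin M.mult,
    derivIdealSheafIter φ i M.ideal ^ (∏ j ∈ Finset.univ.erase i, (M.mult - (j : ℕ))) := rfl

/-- Unfolding. [folklore] -/
@[simp] theorem coeff_boundary (M : MarkedIdeal X) : (M.coeff φ).boundary = M.boundary := rfl

/-- Unfolding. [cite: BierstoneGrigorievMilmanWlodarczyk2011, Def. 3.9.2] -/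
theorem coeff_mult_eq_prod (M : MarkedIdeal X) :
    (M.coeff φ).mult = ∏ j : Fin M.mult, (M.mult - (j : ℕ)) := rfl

/-- **The multiplicity of `𝒞(𝓘, μ)` is `μ!`** (`Π_{j<μ} (μ - j) = μ!`).
[cite: BierstoneGrigorievMilmanWlodarczyk2011, Def. 3.9.2] -/
@[simp] theorem coeff_mult (M : MarkedIdeal X) : (M.coeff φ).mult = Nat.factorial M.mult := by
  rw [coeff_mult_eq_prod, Fin.prod_univ_eq_prod_range (fun j => M.mult - j) M.mult,
    ← Finset.prod_range_add_one_eq_factorial, ← Finset.prod_range_reflect (fun j => j + 1) M.mult]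
  refine Finset.prod_congr rfl fun j hj => ?_
  have := Finset.mem_range.mp hj
  omega

/-- The exponent of the `i`-th term times `μ - i` is the total multiplicity:
`(μ - i) · Π_{j≠i} (μ - j) = Π_j (μ - j)`. [folklore] -/
theorem sub_mul_prod_erase (M : MarkedIdeal X) (i : Fin M.mult) :
    (M.mult - (i : ℕ)) * ∏ j ∈ Finset.univ.erase i, (M.mult - (j : ℕ)) =
      ∏ j : Fin M.mult, (M.mult - (j : ℕ)) :=
  Finset.mul_prod_erase Finset.univ (fun j : Fin M.mult => M.mult - (j : ℕ)) (Finset.mem_univ i)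

/-- The `i`-th term of `𝒞(𝓘)`. [cite: BierstoneGrigorievMilmanWlodarczyk2011, Def. 3.9.2] -/
theorem derivIdealSheafIter_pow_le_coeff_ideal (M : MarkedIdeal X) (i : Fin M.mult) :
    derivIdealSheafIter φ i M.ideal ^ (∏ j ∈ Finset.univ.erase i, (M.mult - (j : ℕ))) ≤
      (M.coeff φ).ideal :=
  le_iSup_of_le (f := fun i : Fin M.mult =>
    derivIdealSheafIter φ i M.ideal ^ (∏ j ∈ Finset.univ.erase i, (M.mult - (j : ℕ)))) i le_rfl

variable {φ} in
/-- **Sections of `𝒞(𝓘)` on affine opens are the ring-level coefficient ideals** (`coeffIdeal`,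
`CoefficientIdeals.lean`): `𝒞(𝓘)(U) = 𝒞(𝓘(U)).1`. [cite: BierstoneGrigorievMilmanWlodarczyk2011, Def. 3.9.2] -/
theorem coeff_ideal_apply (hX : HasFinitePresentationDifferentials φ) (M : MarkedIdeal X)
    (U : X.affineOpens) :
    (M.coeff φ).ideal.ideal U = (letI := sectionsAlgebra φ U; (coeffIdeal k (M.ideal.ideal U) M.mult).1) := by
  letI := sectionsAlgebra φ U
  rw [coeff_ideal, coeffIdeal, markedSum_ofFn, Scheme.IdealSheafData.ideal_iSup, iSup_apply,
    Ideal.sum_eq_sup, Finset.sup_eq_iSup]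
  simp only [Finset.mem_univ, iSup_pos]
  refine iSup_congr fun i => ?_
  rw [Scheme.IdealSheafData.ideal_pow, Pi.pow_apply, derivIdealSheafIter_ideal hX]

/-- **The multiplicity of `𝒞(𝓘)` is that of the ring-level `coeffIdeal`** (both `Π_{j<μ}(μ-j)`).
[cite: BierstoneGrigorievMilmanWlodarczyk2011, Def. 3.9.2] -/
theorem coeff_mult_eq_coeffIdeal {A : Type*} [CommRing A] [Algebra k A] (M : MarkedIdeal X)
    (I : Ideal A) : (M.coeff φ).mult = (coeffIdeal k I M.mult).2 := by
  rw [coeff_mult_eq_prod, coeffIdeal, markedSum_ofFn]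

variable {φ}

/-- **Stalks of `𝒞(𝓘)`**: `𝒞(𝓘)_x = Σ_{i<μ} (𝒟ⁱ(𝓘_x))^{Π_{j≠i}(μ-j)}`.
[cite: BierstoneGrigorievMilmanWlodarczyk2011, Def. 3.9.2] -/
theorem stalkIdeal_coeff (hX : HasFinitePresentationDifferentials φ) (M : MarkedIdeal X) (x : X) :
    stalkIdeal (M.coeff φ).ideal x = ⨆ i : Fin M.mult,
      (letI := stalkAlgebra φ x; derivIdealIter k i (stalkIdeal M.ideal x)) ^
        (∏ j ∈ Finset.univ.erase i, (M.mult - (j : ℕ))) := by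
  rw [coeff_ideal, stalkIdeal_iSup]
  refine iSup_congr fun i => ?_
  rw [stalkIdeal_pow, stalkIdeal_derivIdealSheafIter hX]

/-- **`supp(𝓘, μ) ⊆ supp 𝒞(𝓘, μ)`** (the easy half of the support statement of BGMW Lemma 3.9.3
/ Example 3.9.1, every characteristic): at `x ∈ supp(𝓘, μ)`, `𝒟ⁱ(𝓘)_x ⊆ 𝔪_x^{μ-i}`, so the
`i`-th term lies in `𝔪_x^{(μ-i)·Π_{j≠i}(μ-j)} = 𝔪_x^{Π_j(μ-j)}`.
[cite: BierstoneGrigorievMilmanWlodarczyk2011, Lemma 3.9.3] -/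
theorem support_subset_support_coeff (hX : HasFinitePresentationDifferentials φ)
    (M : MarkedIdeal X) : M.support ⊆ (M.coeff φ).support := by
  intro x hx
  rw [mem_support_iff] at hx ⊢
  rw [stalkIdeal_coeff hX, coeff_mult_eq_prod]
  refine iSup_le fun i => ?_
  letI := stalkAlgebra φ x
  calc derivIdealIter k i (stalkIdeal M.ideal x) ^
        (∏ j ∈ Finset.univ.erase i, (M.mult - (j : ℕ)))
      ≤ (maximalIdeal (X.presheaf.stalk x) ^ (M.mult - i)) ^
          (∏ j ∈ Finset.univ.erase i, (M.mult - (j : ℕ))) :=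
        Ideal.pow_right_mono (derivIdealIter_le_pow_sub k hx i) _
    _ = maximalIdeal (X.presheaf.stalk x) ^ (∏ j : Fin M.mult, (M.mult - (j : ℕ))) := by
        rw [← pow_mul, M.sub_mul_prod_erase i]

/-- **`supp 𝒞(𝓘, μ) = supp(𝓘, μ)` at regular points** (the support statement of BGMW
Lemma 3.9.3, `𝒞(𝓘, μ) ≃ (𝓘, μ)`; Example 3.9.1), for `μ ≥ 1`: if `𝒞(𝓘)_x ⊆ 𝔪_x^{μ!}` then in
particular the `i = 0` term gives `𝓘_x^{(μ-1)!} ⊆ 𝔪_x^{μ·(μ-1)!}`, whence `𝓘_x ⊆ 𝔪_x^μ` in the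
regular local ring `𝒪_{X,x}` (`ord_x(fᵉ) = e·ord_x f`, `Ideal.pow_le_pow_mul_iff`).
[cite: BierstoneGrigorievMilmanWlodarczyk2011, Lemma 3.9.3] -/
theorem support_coeff (hX : HasFinitePresentationDifferentials φ) (M : MarkedIdeal X)
    (hμ : M.mult ≠ 0) (hreg : ∀ x ∈ (M.coeff φ).support, IsRegularLocalRing (X.presheaf.stalk x)) :
    (M.coeff φ).support = M.support := by
  refine Set.Subset.antisymm (fun x hx => ?_) (M.support_subset_support_coeff hX)
  haveI := hreg x hx
  rw [mem_support_iff] at hx ⊢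
  rw [stalkIdeal_coeff hX, coeff_mult_eq_prod] at hx
  have h0 : (0 : ℕ) < M.mult := Nat.pos_of_ne_zero hμ
  have hterm := (le_iSup_of_le (f := fun i : Fin M.mult =>
      (letI := stalkAlgebra φ x; derivIdealIter k i (stalkIdeal M.ideal x)) ^
        (∏ j ∈ Finset.univ.erase i, (M.mult - (j : ℕ)))) ⟨0, h0⟩ le_rfl).trans hx
  letI := stalkAlgebra φ x
  change derivIdealIter k 0 (stalkIdeal M.ideal x) ^
      (∏ j ∈ Finset.univ.erase (⟨0, h0⟩ : Fin M.mult), (M.mult - (j : ℕ))) ≤ _ at hterm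
  rw [derivIdealIter_zero, ← M.sub_mul_prod_erase ⟨0, h0⟩, Nat.sub_zero, mul_comm] at hterm
  have he : 0 < ∏ j ∈ Finset.univ.erase (⟨0, h0⟩ : Fin M.mult), (M.mult - (j : ℕ)) :=
    Finset.prod_pos fun j _ => by
      have := j.2
      omega
  exact (Ideal.pow_le_pow_mul_iff he).mp hterm

end MarkedIdeal

end Literature.AlgebraicGeometry.Resolution

end
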